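import Summits.BirchSwinnertonDyer.BirchSwinnertonDyer.Theorems.ErratumRoadFiveNonSurjCornerImageFull
import Literature.NumberTheory.EllipticCurves.SupersingularDensitySerreTraceProofs
import Literature.NumberTheory.EllipticCurves.ModPIrreducibleCongruenceTransferProofs
import Mathlib.LinearAlgebra.Trace
import Mathlib.LinearAlgebra.Determinant
import HarnessLib

/-!
# Route `ErratumRoadFive` (K2), crux `NonSurjCorner` (item stmt-BirchSwinnertonDyer-19065) ∕ child `NonSurjCornerTwinMuAn` (19948):
# THE TRACE TEST ON THE CORNER AT `p ≥ 7` — every Frobenius has a SQUARE discriminant or trace zero: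
# `p ∣ a_ℓ(E)` or `a_ℓ(E)² − 4ℓ` is a square mod `p`, at every good prime `ℓ ≠ p`
# (cell `bsd-stepL`, WIDTH-LEVER lane B `bsd-stepL-corner5-p2` g10; `--supports stmt-BirchSwinnertonDyer-19948 --as helper`)

WHY. Companion of `…NonSurjCornerFrobeniusOrders` (the `p = 5` trace test). At `p ≥ 7` the image of a pair with `E` multiplicative at `p`,
`E[p]` irreducible and `ρ̄_{E,p}` not onto is EXACTLY the normaliser of a split Cartan subgroup (`pNs`; lane B g2,
`CornerShape.image_eq_normalizer_splitCartan`), whose elements are, in the frame `P`, DIAGONAL (eigenvalues in `𝔽_p`: the discriminant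
`tr² − 4 det = (a − d)²` is a square) or ANTIDIAGONAL (trace `0`). At a good prime `ℓ ≠ p` the Frobenius has trace `a_ℓ(E)` and determinant
`ℓ` on `E[p]`, whence the test: `p ∣ a_ℓ(E)` or `a_ℓ(E)² − 4ℓ` is a square mod `p` — the split twin of the tree's non-split law
`EtaCartanField.dvd_frobeniusTrace_or_discr` («`p ∣ a_ℓ` or `a_ℓ² − 4ℓ` is `0` or a NON-residue» on `C_ns⁺(p)` images). In lane B's
Serre-level census at `p = 7` a newform class `(g, ℘)` is discarded as «not a corner class» at the first coefficient with `℘ ∤ a_ℓ(g)` and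
`a_ℓ(g)² − 4ℓ` a non-residue mod `℘` (projective order `4`, `8` or any order not dividing `p − 1` off the antidiagonal coset).

* §1 `traceSq_sub_four_det_isSquare_or_trace_eq_zero_of_mem_normalizer` — group theory in `GL₂(𝔽_p)`.
* §2 `NonSurjCorner.dvd_frobeniusTrace_or_isSquare_discr` — the trace test (`p ≥ 7`, Mult, Irr, ¬Surj; any good `ℓ ≠ p`), and the instances
  over the route binders `NonSurjTwin.traceTest_seven` (19948's population at `7`, `ClassX11a`) ∕ `NonSurjCorner.traceTest_seven` (19065's, `ClassX11b`).

HONEST FRAMING: structure theorems about Galois images; no named fact beyond those inside the imported image file (none used here); nothing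
proves the crux, a registered stub or BSD for any class; no census number moves (T7). [cite: Serre1972, §2.2, §2.7 Prop. 17] [cite: Zywina2015, Thm. 1.5]
-/

set_option linter.dupNamespace false -- `Summit.BirchSwinnertonDyer.BirchSwinnertonDyer` (summit = problem), tree-wide

noncomputable section

open scoped Classical NumberField

namespace Summit.BirchSwinnertonDyer.BirchSwinnertonDyer.Theorems.CornerShape

open WeierstrassCurve NumberField IsDedekindDomain Field Matrix
  Literature.NumberTheory.EllipticCurves Literature.NumberTheory.GaloisRepresentations
  Literature.NumberTheory.GaloisRepresentations.Serre1972
  Literature.NumberTheory.EllipticCurves.Rank1Residual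
  Rat.HeightOneSpectrum
  Summit.BirchSwinnertonDyer.Rank1Residual Summit.BirchSwinnertonDyer.Rank1Residual.GaloisImage

/-! ### §1. Group theory: elements of the normaliser of a split Cartan subgroup -/

/-- **An element of `N(P (* 0; 0 *) P⁻¹)` has a square discriminant or trace zero**: in the frame `P` it is diagonal (`tr² − 4 det = (a − d)²`)
or antidiagonal (`tr = 0`); trace and determinant are class functions (`|F| ≥ 3`). [cite: Serre1972, §2.2] -/
theorem traceSq_sub_four_det_isSquare_or_trace_eq_zero_of_mem_normalizer {p : ℕ} [Fact p.Prime] (hp3 : 3 ≤ p)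
    {P x : GL (Fin 2) (ZMod p)} (hx : x ∈ Subgroup.normalizer (splitCartan P : Set (GL (Fin 2) (ZMod p)))) :
    IsSquare ((Matrix.trace (x : Matrix (Fin 2) (Fin 2) (ZMod p))) ^ 2 - 4 * Matrix.det (x : Matrix (Fin 2) (Fin 2) (ZMod p))) ∨
      Matrix.trace (x : Matrix (Fin 2) (Fin 2) (ZMod p)) = 0 := by
  set N : GL (Fin 2) (ZMod p) := P⁻¹ * x * P with hN
  have hNx : (N : Matrix (Fin 2) (Fin 2) (ZMod p)) =
      (P⁻¹ : GL (Fin 2) (ZMod p)) * (x : Matrix (Fin 2) (Fin 2) (ZMod p)) * (P : GL (Fin 2) (ZMod p)) := by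
    rw [hN, Units.val_mul, Units.val_mul]
  have htr : Matrix.trace (N : Matrix (Fin 2) (Fin 2) (ZMod p)) = Matrix.trace (x : Matrix (Fin 2) (Fin 2) (ZMod p)) := by
    rw [hNx, Matrix.mul_assoc, Matrix.trace_mul_comm, Matrix.mul_assoc, ← Units.val_mul, mul_inv_cancel,
      Units.val_one, Matrix.mul_one]
  have hdet : Matrix.det (N : Matrix (Fin 2) (Fin 2) (ZMod p)) = Matrix.det (x : Matrix (Fin 2) (Fin 2) (ZMod p)) := by
    rw [hNx, Matrix.det_mul, Matrix.det_mul, mul_right_comm, ← Matrix.det_mul, ← Units.val_mul, inv_mul_cancel,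
      Units.val_one, Matrix.det_one, one_mul]
  rw [← htr, ← hdet]
  rcases (mem_normalizer_splitCartan_iff (exists_units_ne_one (by omega))).mp hx with hdg | had
  · -- diagonal in the frame `P`
    left
    refine ⟨(N : Matrix (Fin 2) (Fin 2) (ZMod p)) 0 0 - (N : Matrix (Fin 2) (Fin 2) (ZMod p)) 1 1, ?_⟩
    rw [Matrix.trace_fin_two, Matrix.det_fin_two, hdg.1, hdg.2]
    ring
  · -- antidiagonal: trace zero
    right
    rw [Matrix.trace_fin_two, had.1, had.2, add_zero]

/-! ### §2. The trace test at the good primes, `p ≥ 7` -/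

/-- **THE TRACE TEST ON THE CORNER AT `p ≥ 7`.** `E/ℚ` globally minimal, `p ≥ 7` multiplicative, `E[p]` irreducible, `ρ̄_{E,p}` NOT onto ⟹ at
every prime `ℓ ≠ p` of good reduction: `p ∣ a_ℓ(E)` or `a_ℓ(E)² − 4ℓ` is a square mod `p` (the Frobenius at `ℓ`, of trace `a_ℓ` and
determinant `ℓ` on `E[p]`, lies in the normaliser of a split Cartan subgroup: diagonalisable over `𝔽_p` or of trace `0`).
[cite: Serre1972, §2.2, §2.7 Prop. 17] [cite: Zywina2015, Thm. 1.5] -/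
theorem NonSurjCorner.dvd_frobeniusTrace_or_isSquare_discr (W : WeierstrassCurve ℚ) [W.IsElliptic] [W.IsGloballyMinimal]
    (p : ℕ) [Fact p.Prime] (hp7 : 7 ≤ p) (hmult : Mult W p) (hirr : Irr W p) (hns : ¬ Surj W p)
    (ℓ : ℕ) [hℓ : Fact ℓ.Prime] (hℓp : ℓ ≠ p) (hgood : W.HasGoodReductionAtPrime ℓ) :
    (p : ℤ) ∣ W.frobeniusTrace ℓ ∨ IsSquare ((W.frobeniusTrace ℓ ^ 2 - 4 * ℓ : ℤ) : ZMod p) := by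
  letI : Module (ZMod p) (W.geomTorsion (p : ℕ)) := AddSubgroup.torsionBy.zmodModule
  obtain ⟨e, Φ, he, htr, -⟩ := exists_frame_galoisRepTorsion_rat W p
  obtain ⟨P, hG⟩ := image_eq_normalizer_splitCartan W p Φ e he hp7 hmult hirr hns
  -- an arithmetic Frobenius `σ` at a prime above `ℓ`
  obtain ⟨w, hw⟩ : ∃ w : HeightOneSpectrum (𝓞 ℚ), (primesEquiv w : ℕ) = ℓ :=
    ⟨primesEquiv.symm ⟨ℓ, hℓ.out⟩, by rw [Equiv.apply_symm_apply]⟩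
  obtain ⟨𝔓, h𝔓⟩ := HeightOneSpectrum.primesAbove_nonempty w
  obtain ⟨σ, hσ⟩ := HeightOneSpectrum.exists_isArithFrobAt_of_mem_primesAbove_holds h𝔓
  set x : GL (Fin 2) (ZMod p) := Φ (galoisRepTorsion W (p : ℕ) σ) with hxdef
  have hx : x ∈ (galoisRepTorsion W (p : ℕ)).range.map Φ.toMonoidHom :=
    ⟨galoisRepTorsion W (p : ℕ) σ, ⟨σ, rfl⟩, rfl⟩
  rw [hG] at hx
  have key := traceSq_sub_four_det_isSquare_or_trace_eq_zero_of_mem_normalizer (by omega) hx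
  -- trace = a_ℓ, det = ℓ (mod p)
  have htrace : Matrix.trace (x : Matrix (Fin 2) (Fin 2) (ZMod p)) = (W.frobeniusTrace ℓ : ZMod p) := by
    rw [hxdef, htr]
    exact W.trace_galoisRepTorsion_frobenius_eq p hℓp hgood hw h𝔓 hσ
  have hσM : ∀ Q : W.geomTorsion (p : ℕ), e (σ • Q) = (x : Matrix (Fin 2) (Fin 2) (ZMod p)) *ᵥ e Q := fun Q ↦ by
    rw [← galoisRepTorsion_apply]; exact he _ Q
  have hdet : Matrix.det (x : Matrix (Fin 2) (Fin 2) (ZMod p)) = (ℓ : ZMod p) := by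
    rw [← W.det_galoisRepTorsion_frobenius_eq p hℓp hgood hw h𝔓 hσ]
    let eL : W.geomTorsion (p : ℕ) ≃ₗ[ZMod p] (Fin 2 → ZMod p) :=
      LinearEquiv.ofBijective (e.toAddMonoidHom.toZModLinearMap p) ⟨e.injective, e.surjective⟩
    have heL : ∀ Q : W.geomTorsion (p : ℕ), eL Q = e Q := fun _ ↦ rfl
    have hconj : Matrix.toLin' (x : Matrix (Fin 2) (Fin 2) (ZMod p)) =
        eL.conj ((galoisRepTorsion W (p : ℕ) σ).toAdd.toAddMonoidHom.toZModLinearMap p) := by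
      refine LinearMap.ext fun u ↦ ?_
      obtain ⟨Q, rfl⟩ := eL.surjective u
      rw [LinearEquiv.conj_apply_apply, eL.symm_apply_apply, heL, heL, Matrix.toLin'_apply]
      change (x : Matrix (Fin 2) (Fin 2) (ZMod p)) *ᵥ (e Q) = e (σ • Q)
      rw [hσM]
    rw [← LinearMap.det_toLin' (x : Matrix (Fin 2) (Fin 2) (ZMod p)), hconj, LinearEquiv.conj_apply,
      LinearMap.comp_assoc, LinearMap.det_conj]
  rw [htrace, hdet] at key
  rcases key with hsq | h0
  · right
    have : ((W.frobeniusTrace ℓ ^ 2 - 4 * ℓ : ℤ) : ZMod p) = (W.frobeniusTrace ℓ : ZMod p) ^ 2 - 4 * (ℓ : ZMod p) := by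
      push_cast; ring
    rw [this]; exact hsq
  · left
    exact (ZMod.intCast_zmod_eq_zero_iff_dvd _ p).mp h0

/-- **The trace test on 19948's population at `7`** (`ClassX11a`, `ρ̄` not onto): at every good `ℓ ≠ 7`, `7 ∣ a_ℓ` or `a_ℓ² − 4ℓ` is a
square mod `7`. [cite: Serre1972, §2.2] [cite: Zywina2015, Thm. 1.5] -/
theorem NonSurjTwin.traceTest_seven (Wd : WeierstrassCurve ℚ) [Wd.IsElliptic] [Wd.IsGloballyMinimal] [Fact (Nat.Prime 7)]
    (hX : ClassX11a Wd 7) (hns : ¬ Surj Wd 7) (ℓ : ℕ) [Fact ℓ.Prime] (hℓ7 : ℓ ≠ 7) (hgood : Wd.HasGoodReductionAtPrime ℓ) :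
    (7 : ℤ) ∣ Wd.frobeniusTrace ℓ ∨ IsSquare ((Wd.frobeniusTrace ℓ ^ 2 - 4 * ℓ : ℤ) : ZMod 7) :=
  NonSurjCorner.dvd_frobeniusTrace_or_isSquare_discr Wd 7 le_rfl hX.2.2.1 hX.2.2.2.1 hns ℓ hℓ7 hgood

/-- **The trace test on 19065's population at `7`** (`ClassX11b`, `ρ̄` not onto): at every good `ℓ ≠ 7`, `7 ∣ a_ℓ` or `a_ℓ² − 4ℓ` is a
square mod `7`. [cite: Serre1972, §2.2] [cite: Zywina2015, Thm. 1.5] -/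
theorem NonSurjCorner.traceTest_seven (W : WeierstrassCurve ℚ) [W.IsElliptic] [W.IsGloballyMinimal] [Fact (Nat.Prime 7)]
    (hX : ClassX11b W 7) (hns : ¬ Surj W 7) (ℓ : ℕ) [Fact ℓ.Prime] (hℓ7 : ℓ ≠ 7) (hgood : W.HasGoodReductionAtPrime ℓ) :
    (7 : ℤ) ∣ W.frobeniusTrace ℓ ∨ IsSquare ((W.frobeniusTrace ℓ ^ 2 - 4 * ℓ : ℤ) : ZMod 7) :=
  NonSurjCorner.dvd_frobeniusTrace_or_isSquare_discr W 7 le_rfl hX.2.2.1 hX.2.2.2 hns ℓ hℓ7 hgood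

end Summit.BirchSwinnertonDyer.BirchSwinnertonDyer.Theorems.CornerShape

end
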